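import Summits.MatrixMultiplication.MatrixMultiplication.Theorems.SoloBlindHypergraph

/-!
# The finite hypergraph form of (K₃) itself: balanced hypergraphs

Sub-programme (K₃).  `SoloBlindHypergraph` showed that the atom hypergraph of an H-GOOD target is admissible and
reduced Conjecture E to the hypergraph Kraft conjecture `K ≤ 1/2`.  At an ARBITRARY target `σ` of a zero-sum-free
`h` (exponent `3`) the atom hypergraph is still BALANCED (`soloBlindHgBalanced`: edges separate vertices, and
every functional `c : F → 𝔽₃` of total `0` takes the value `1` on some edge iff it takes the value `2` on some
edge) — `soloBlind_atomHg_balanced`; only the total-`1` clause of admissibility needs H-goodness.  Hence the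
BALANCED HYPERGRAPH KRAFT CONJECTURE (`soloBlindHgKraftOneConj W`: a balanced hypergraph with edges inside its
finite vertex set has `∑_v 2^{-deg v} ≤ 1`) implies the full Kraft inequality (K₃) directly
(`soloBlind_kraft_of_hgKraftOne`), and an admissible hypergraph is balanced (`soloBlind_hgBalanced_of_admissible`).
[Pen: conversely every balanced hypergraph is realised inside the representation family of a target of a
zero-sum-free sequence (`G = 𝔽₃^F / L`), so the conjecture is equivalent to (K₃); the admissible case is the
pointed case `P ∋ {∞}`, matching `E ⟺ (K₃)`.]
-/

namespace Summit.MatrixMultiplication.MatrixMultiplication.Theorems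

open Finset

universe u v

section Hypergraph

variable {W : Type*}

/-- BALANCED hypergraph on the vertex set `F`: edges separate vertices, and every `𝔽₃`-functional of total `0`
takes the value `1` on some edge iff it takes the value `2` on some edge. -/
def soloBlindHgBalanced (F : Finset W) (P : Finset (Finset W)) : Prop :=
  (∀ u ∈ F, ∀ w ∈ F, u ≠ w → ∃ J ∈ P, ¬ (u ∈ J ↔ w ∈ J)) ∧
  (∀ c : W → ZMod 3, ∑ v ∈ F, c v = 0 →
    ((∃ J ∈ P, soloBlindHgVal c J = 1) ↔ (∃ J ∈ P, soloBlindHgVal c J = 2)))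

/-- An admissible hypergraph is balanced. -/
theorem soloBlind_hgBalanced_of_admissible {F : Finset W} {P : Finset (Finset W)}
    (h : soloBlindHgAdmissible F P) : soloBlindHgBalanced F P :=
  ⟨h.1, h.2.2⟩

/-- THE BALANCED HYPERGRAPH KRAFT CONJECTURE over the vertex type `W`: every balanced hypergraph whose edges lie
inside its finite vertex set `F` has Kraft sum at most `1`. -/
def soloBlindHgKraftOneConj (W : Type*) [DecidableEq W] : Prop :=
  ∀ (F : Finset W) (P : Finset (Finset W)), (∀ J ∈ P, J ⊆ F) →
    soloBlindHgBalanced F P → soloBlindHgKraft F P ≤ 1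

end Hypergraph

variable {ι : Type v} [DecidableEq ι]
variable {G : Type u} [AddCommGroup G] [DecidableEq G]

/-- THE ATOM HYPERGRAPH OF ANY TARGET IS BALANCED (zero-sum free, exponent `3`; no H-goodness needed). -/
theorem soloBlind_atomHg_balanced (three : ∀ g : G, g + g + g = 0) {h : ι → G} {S : Finset ι} {σ : G}
    (zsf : ∀ T ⊆ S, T.Nonempty → ∑ i ∈ T, h i ≠ 0) :
    soloBlindHgBalanced (soloBlindSeqRepAll h S σ) (soloBlindAtomHg h S σ) := by
  refine ⟨?_, ?_⟩
  · -- separation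
    intro u hu w hw huw
    have hx : ∃ x, ¬ (x ∈ u ↔ x ∈ w) := by
      by_contra hcon
      push Not at hcon
      exact huw (Finset.ext hcon)
    obtain ⟨x, hx⟩ := hx
    have hxS : x ∈ S := by
      by_cases hxu : x ∈ u
      · exact (soloBlind_mem_seqRepAll.mp hu).1 hxu
      · have hxw : x ∈ w := by tauto
        exact (soloBlind_mem_seqRepAll.mp hw).1 hxw
    refine ⟨soloBlindAtom h S σ x, Finset.mem_image.mpr ⟨x, hxS, rfl⟩, ?_⟩
    simpa [soloBlind_mem_atom, hu, hw] using hx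
  · -- functionals of total 0
    intro c hc0
    set U := S.filter (fun x => (∑ T ∈ soloBlindAtom h S σ x, (c T).val) % 3 = 1) with hU
    set V := S.filter (fun x => (∑ T ∈ soloBlindAtom h S σ x, (c T).val) % 3 = 2) with hV
    have hid := soloBlind_atom_identity three h S σ c
    have hm : (∑ T ∈ soloBlindSeqRepAll h S σ, (c T).val) % 3 = 0 := by
      rw [← soloBlind_val_sum_mod_three, hc0]; rfl
    rw [← hU, ← hV, hm, zero_nsmul] at hid
    have hUS : U ⊆ S := Finset.filter_subset _ _
    have hVS : V ⊆ S := Finset.filter_subset _ _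
    have mem_of_val : ∀ k : ℕ, k < 3 → (∃ J ∈ soloBlindAtomHg h S σ, soloBlindHgVal c J = (k : ZMod 3)) →
        ∃ x ∈ S, (∑ T ∈ soloBlindAtom h S σ x, (c T).val) % 3 = k := by
      intro k hk ⟨J, hJ, hJk⟩
      obtain ⟨x, hxS, rfl⟩ := Finset.mem_image.mp hJ
      exact ⟨x, hxS, (soloBlind_atom_val_eq c x k hk).mp hJk⟩
    have val_of_mem : ∀ k : ℕ, k < 3 → (∃ x ∈ S, (∑ T ∈ soloBlindAtom h S σ x, (c T).val) % 3 = k) →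
        ∃ J ∈ soloBlindAtomHg h S σ, soloBlindHgVal c J = (k : ZMod 3) := by
      intro k hk ⟨x, hxS, hxk⟩
      exact ⟨soloBlindAtom h S σ x, Finset.mem_image.mpr ⟨x, hxS, rfl⟩,
        (soloBlind_atom_val_eq c x k hk).mpr hxk⟩
    constructor
    · intro h1
      by_contra h2
      have hVe : V = ∅ := by
        rw [Finset.eq_empty_iff_forall_notMem]
        intro x hx
        obtain ⟨hxS, hx2⟩ := Finset.mem_filter.mp hx
        exact h2 (by simpa using val_of_mem 2 (by norm_num) ⟨x, hxS, hx2⟩)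
      rw [hVe, Finset.sum_empty, add_zero, add_zero] at hid
      obtain ⟨x, hxS, hx1⟩ := mem_of_val 1 (by norm_num) (by simpa using h1)
      exact zsf U hUS ⟨x, Finset.mem_filter.mpr ⟨hxS, hx1⟩⟩ hid
    · intro h2
      by_contra h1
      have hUe : U = ∅ := by
        rw [Finset.eq_empty_iff_forall_notMem]
        intro x hx
        obtain ⟨hxS, hx1⟩ := Finset.mem_filter.mp hx
        exact h1 (by simpa using val_of_mem 1 (by norm_num) ⟨x, hxS, hx1⟩)
      rw [hUe, Finset.sum_empty, zero_add] at hid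
      obtain ⟨x, hxS, hx2⟩ := mem_of_val 2 (by norm_num) (by simpa using h2)
      apply zsf V hVS ⟨x, Finset.mem_filter.mpr ⟨hxS, hx2⟩⟩
      have h3 := three (∑ i ∈ V, h i)
      rwa [hid, zero_add] at h3

/-- MAIN THEOREM: the balanced hypergraph Kraft conjecture (over the vertex type `Finset ι`) implies the full
Kraft inequality (K₃) `soloBlindMass h S σ ≤ 1` at EVERY target, for `h : ι → G` zero-sum free on `S`,
`G` of exponent `3` — directly, in every rank. -/
theorem soloBlind_kraft_of_hgKraftOne (hC : soloBlindHgKraftOneConj (Finset ι))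
    (three : ∀ g : G, g + g + g = 0) (h : ι → G) (S : Finset ι)
    (zsf : ∀ T ⊆ S, T.Nonempty → ∑ i ∈ T, h i ≠ 0) (σ : G) : soloBlindMass h S σ ≤ 1 :=
  (soloBlind_mass_le_hgKraft h S σ).trans
    (hC _ _ (soloBlind_atomHg_edge_subset h S σ) (soloBlind_atomHg_balanced three zsf))

/-- COROLLARY: the balanced hypergraph Kraft conjecture also gives Conjecture E (through (K₃) and the virtual
point, `soloBlind_conjE_of_kraft`). -/
theorem soloBlind_conjE_of_hgKraftOne
    (hC : ∀ {κ : Type v} [DecidableEq κ], soloBlindHgKraftOneConj (Finset κ))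
    (three : ∀ g : G, g + g + g = 0) (h : ι → G) (S : Finset ι)
    (zsf : ∀ T ⊆ S, T.Nonempty → ∑ i ∈ T, h i ≠ 0) (τ : G)
    (hgood : ∀ T ⊆ S, ∑ i ∈ T, h i ≠ τ + τ) : soloBlindMass h S τ ≤ 1 / 2 := by
  classical
  have zsf' := soloBlind_adjoin_zsf three zsf hgood
  have hv := soloBlind_kraft_of_hgKraftOne hC three (soloBlindAdjoin h τ) (insertNone S) zsf' τ
  rw [soloBlind_adjoin_mass zsf'] at hv
  linarith

end Summit.MatrixMultiplication.MatrixMultiplication.Theorems
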